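import Summits.Ventures.HodgeRepro2.T5SU11ResolventGroundStateWeight
import Summits.Ventures.HodgeRepro2.T5SU11ResolventNeumann

/-!
# The resolvent on the ground-state weighted space `W_1 = {|g| ≤ D Ξ}`: iterates, Lipschitz bound, Neumann series with the
sharp disc `|μ − μ₂| < (λ₂ − 1)²`

Row 556 shows that `G^I_λ` maps `W_1` into itself with `‖G^I_λ‖ ≤ 1/(λ − 1)²` for every `λ > 1`, with no hypothesis beyond
`g ∈ W_1`. Iterating, and using row 500's resolvent identity and row 503's finite Neumann expansion (whose class data are
supplied by row 556's `class_of_le_mul_sph_one` at the common rate `(3 − min(λ, λ₂))/2`):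

* `iterate_mem_weighted_one` — **`(G^I_λ)ⁿ g ∈ W_1` with `|(G^I_λ)ⁿ g(t)| ≤ D Ξ(t)/((λ − 1)²)ⁿ`**;
* `abs_greenSolI_sub_le_mul_sph_one` — **`|G^I_λ g(t) − G^I_{λ₂} g(t)| ≤ |μ − μ₂| D Ξ(t)/((λ − 1)² (λ₂ − 1)²)`**;
* `abs_neumann_remainder_le_mul_sph_one`, `tendsto_neumann_weighted_one` — **the Neumann series
  `Σ (μ − μ₂)^k (G^I_{λ₂})^{k+1} g` converges to `G^I_λ g` in the `Ξ`-weighted sup-norm for `|μ − μ₂| < (λ₂ − 1)²`**, with the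
  remainder `≤ (|μ − μ₂|/(λ₂ − 1)²)^{n+1} D Ξ(t)/(λ − 1)²` — the disc of radius `dist(μ₂, −1) = dist(μ₂, −ρ²)`, the distance
  from `μ₂` to the bottom of the spectrum, i.e. the sharp disc of analyticity of the resolvent.

Nothing is claimed about (N).

Blind lane: Mathlib + the HodgeRepro2 prefix only; no sorry; axioms ⊆ {propext, Classical.choice,
Quot.sound}.
-/

namespace Summit.Ventures.HodgeRepro2.T5SU11WeightedSpaceGroundState

open Filter Topology MeasureTheory
open Set (Ioi Ioc)
open T5SU11Cartan T5SU11SphericalFunction T5SU11SphericalDecay T5SU11RadialGreenImproper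
  T5SU11RadialGreenImproperStable T5SU11ResolventIdentityDecay T5SU11ResolventNeumann
  T5SU11ResolventGroundStateWeight

section measure

variable [MeasurableSpace Circle] [BorelSpace Circle]

variable {lam : ℝ} (hlam : 1 < lam) {g : ℝ → ℝ} (hg : ContinuousOn g (Ioi 0))
  {D : ℝ} (hD : ∀ s, 0 < s → |g s| ≤ D * sph 1 (hyp s))

include hlam hg hD in
/-- **The iterates stay in `W_1` with the sharp constants**: `(G^I_λ)ⁿ g` is continuous on `(0, ∞)` and
`|(G^I_λ)ⁿ g(t)| ≤ D Ξ(t)/((λ − 1)²)ⁿ`. -/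
theorem iterate_mem_weighted_one (n : ℕ) :
    ContinuousOn ((greenSolI (fun t => sph lam (hyp t)) (sphDecay lam))^[n] g) (Ioi 0) ∧
      ∀ t, 0 < t → |((greenSolI (fun t => sph lam (hyp t)) (sphDecay lam))^[n] g) t|
        ≤ D * sph 1 (hyp t) / ((lam - 1) ^ 2) ^ n := by
  induction n with
  | zero => exact ⟨hg, fun t ht => by simpa using hD t ht⟩
  | succ n ih =>
    obtain ⟨hcont, hbound⟩ := ih
    have hDn : ∀ s, 0 < s → |((greenSolI (fun t => sph lam (hyp t)) (sphDecay lam))^[n] g) s|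
        ≤ (D / ((lam - 1) ^ 2) ^ n) * sph 1 (hyp s) := by
      intro s hs
      rw [div_mul_eq_mul_div]
      exact hbound s hs
    obtain ⟨hcont', hbound'⟩ := greenSolI_mem_weighted_one hlam hcont hDn
    rw [Function.iterate_succ_apply']
    refine ⟨hcont', fun t ht => ?_⟩
    calc |greenSolI (fun t => sph lam (hyp t)) (sphDecay lam)
          ((greenSolI (fun t => sph lam (hyp t)) (sphDecay lam))^[n] g) t|
        ≤ (D / ((lam - 1) ^ 2) ^ n / (lam - 1) ^ 2) * sph 1 (hyp t) := hbound' t ht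
      _ = D * sph 1 (hyp t) / ((lam - 1) ^ 2) ^ (n + 1) := by
          rw [pow_succ ((lam - 1) ^ 2) n, div_div, div_mul_eq_mul_div]

include hlam hg hD in
/-- **The resolvent is Lipschitz in `μ` on `W_1`**: `|G^I_λ g(t) − G^I_{λ₂} g(t)| ≤ |μ − μ₂| D Ξ(t)/((λ − 1)² (λ₂ − 1)²)`
(`λ, λ₂ > 1`). -/
theorem abs_greenSolI_sub_le_mul_sph_one {lam₂ : ℝ} (hlam₂ : 1 < lam₂) {t : ℝ} (ht : 0 < t) :
    |greenSolI (fun t => sph lam (hyp t)) (sphDecay lam) g t - greenSolI (fun t => sph lam₂ (hyp t)) (sphDecay lam₂) g t|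
      ≤ |lam * (lam - 2) - lam₂ * (lam₂ - 2)| * D * sph 1 (hyp t) / ((lam - 1) ^ 2 * (lam₂ - 1) ^ 2) := by
  -- the class data of `g` at the common rate `(3 − min(λ, λ₂))/2`
  have hmin : 1 < min lam lam₂ := lt_min hlam hlam₂
  obtain ⟨hM, hD0, hε, C, hC⟩ := class_of_le_mul_sph_one hmin hD
  have hε₁ : 2 - lam < (3 - min lam lam₂) / 2 := by linarith [min_le_left lam lam₂]
  have hε₂ : 2 - lam₂ < (3 - min lam lam₂) / 2 := by linarith [min_le_right lam lam₂]
  have hp1 : 0 < (lam - 1) ^ 2 := by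
    have : 0 < lam - 1 := by linarith
    positivity
  have hp2 : 0 < (lam₂ - 1) ^ 2 := by
    have : 0 < lam₂ - 1 := by linarith
    positivity
  rw [greenSolI_sub_greenSolI_eq hlam hlam₂ hg hM hD0 hε₁ hε₂ hC ht, abs_mul]
  -- `G^I_{λ₂} g ∈ W_1` with the constant `D/(λ₂ − 1)²`, then the sharp bound at `λ`
  obtain ⟨hcont₂, hbound₂⟩ := greenSolI_mem_weighted_one hlam₂ hg hD
  have hstep := abs_greenSolI_le_mul_sph_one' hlam hcont₂ hbound₂ ht
  calc |lam * (lam - 2) - lam₂ * (lam₂ - 2)|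
        * |greenSolI (fun t => sph lam (hyp t)) (sphDecay lam) (greenSolI (fun t => sph lam₂ (hyp t)) (sphDecay lam₂) g) t|
      ≤ |lam * (lam - 2) - lam₂ * (lam₂ - 2)| * (D / (lam₂ - 1) ^ 2 * sph 1 (hyp t) / (lam - 1) ^ 2) :=
        mul_le_mul_of_nonneg_left hstep (abs_nonneg _)
    _ = |lam * (lam - 2) - lam₂ * (lam₂ - 2)| * D * sph 1 (hyp t) / ((lam - 1) ^ 2 * (lam₂ - 1) ^ 2) := by
        field_simp

include hlam hg hD in
/-- **The remainder of the Neumann series on `W_1`**: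
`|G^I_λ g(t) − Σ_{k ≤ n} (μ − μ₂)^k (G^I_{λ₂})^{k+1} g(t)| ≤ (|μ − μ₂|/(λ₂ − 1)²)^{n+1} D Ξ(t)/(λ − 1)²`. -/
theorem abs_neumann_remainder_le_mul_sph_one {lam₂ : ℝ} (hlam₂ : 1 < lam₂) (n : ℕ) {t : ℝ} (ht : 0 < t) :
    |greenSolI (fun t => sph lam (hyp t)) (sphDecay lam) g t
        - ∑ k ∈ Finset.range (n + 1), (lam * (lam - 2) - lam₂ * (lam₂ - 2)) ^ k
          * (greenSolI (fun t => sph lam₂ (hyp t)) (sphDecay lam₂))^[k + 1] g t|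
      ≤ (|lam * (lam - 2) - lam₂ * (lam₂ - 2)| / (lam₂ - 1) ^ 2) ^ (n + 1) * (D * sph 1 (hyp t) / (lam - 1) ^ 2) := by
  have hmin : 1 < min lam lam₂ := lt_min hlam hlam₂
  obtain ⟨hM, hD0, hε, C, hC⟩ := class_of_le_mul_sph_one hmin hD
  have hε₁ : 2 - lam < (3 - min lam lam₂) / 2 := by linarith [min_le_left lam lam₂]
  have hε₂ : 2 - lam₂ < (3 - min lam lam₂) / 2 := by linarith [min_le_right lam lam₂]
  have hp1 : 0 < (lam - 1) ^ 2 := by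
    have : 0 < lam - 1 := by linarith
    positivity
  have hp2 : 0 < ((lam₂ - 1) ^ 2) ^ (n + 1) := by
    have : 0 < lam₂ - 1 := by linarith
    positivity
  rw [neumann_finite hlam hlam₂ hg hM hD0 hε₁ hε₂ hC n ht, add_sub_cancel_left, abs_mul, abs_pow]
  -- `(G^I_{λ₂})^{n+1} g ∈ W_1` with the constant `D/((λ₂ − 1)²)^{n+1}`, then the sharp bound at `λ`
  obtain ⟨hcont₂, hbound₂⟩ := iterate_mem_weighted_one hlam₂ hg hD (n + 1)
  have hDn : ∀ s, 0 < s → |((greenSolI (fun t => sph lam₂ (hyp t)) (sphDecay lam₂))^[n + 1] g) s|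
      ≤ (D / ((lam₂ - 1) ^ 2) ^ (n + 1)) * sph 1 (hyp s) := by
    intro s hs
    rw [div_mul_eq_mul_div]
    exact hbound₂ s hs
  have hstep := abs_greenSolI_le_mul_sph_one' hlam hcont₂ hDn ht
  calc |lam * (lam - 2) - lam₂ * (lam₂ - 2)| ^ (n + 1)
        * |greenSolI (fun t => sph lam (hyp t)) (sphDecay lam)
          ((greenSolI (fun t => sph lam₂ (hyp t)) (sphDecay lam₂))^[n + 1] g) t|
      ≤ |lam * (lam - 2) - lam₂ * (lam₂ - 2)| ^ (n + 1)
          * (D / ((lam₂ - 1) ^ 2) ^ (n + 1) * sph 1 (hyp t) / (lam - 1) ^ 2) :=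
        mul_le_mul_of_nonneg_left hstep (pow_nonneg (abs_nonneg _) _)
    _ = (|lam * (lam - 2) - lam₂ * (lam₂ - 2)| / (lam₂ - 1) ^ 2) ^ (n + 1) * (D * sph 1 (hyp t) / (lam - 1) ^ 2) := by
        rw [div_pow]
        field_simp

include hlam hg hD in
/-- **THE NEUMANN SERIES CONVERGES IN THE `Ξ`-WEIGHTED SUP-NORM ON THE SHARP DISC `|μ − μ₂| < (λ₂ − 1)²`** (`λ, λ₂ > 1`): the
weighted remainder bound `(|μ − μ₂|/(λ₂ − 1)²)^{n+1} D/(λ − 1)² → 0`, and at every `t > 0` the remainder is at most that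
bound times `Ξ(t)`. -/
theorem tendsto_neumann_weighted_one {lam₂ : ℝ} (hlam₂ : 1 < lam₂)
    (hq : |lam * (lam - 2) - lam₂ * (lam₂ - 2)| < (lam₂ - 1) ^ 2) :
    Tendsto (fun n : ℕ => (|lam * (lam - 2) - lam₂ * (lam₂ - 2)| / (lam₂ - 1) ^ 2) ^ (n + 1) * (D / (lam - 1) ^ 2))
      atTop (𝓝 0) ∧
    ∀ n : ℕ, ∀ t, 0 < t → |greenSolI (fun t => sph lam (hyp t)) (sphDecay lam) g t
        - ∑ k ∈ Finset.range (n + 1), (lam * (lam - 2) - lam₂ * (lam₂ - 2)) ^ k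
          * (greenSolI (fun t => sph lam₂ (hyp t)) (sphDecay lam₂))^[k + 1] g t|
      ≤ ((|lam * (lam - 2) - lam₂ * (lam₂ - 2)| / (lam₂ - 1) ^ 2) ^ (n + 1) * (D / (lam - 1) ^ 2)) * sph 1 (hyp t) := by
  have hp2 : 0 < (lam₂ - 1) ^ 2 := by
    have : 0 < lam₂ - 1 := by linarith
    positivity
  set q := |lam * (lam - 2) - lam₂ * (lam₂ - 2)| / (lam₂ - 1) ^ 2 with hq_def
  have hq0 : 0 ≤ q := by positivity
  have hq1 : q < 1 := by rw [hq_def, div_lt_one hp2]; exact hq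
  refine ⟨?_, fun n t ht => ?_⟩
  · have h := (tendsto_pow_atTop_nhds_zero_of_lt_one hq0 hq1).comp (tendsto_add_atTop_nat 1)
    have h' := h.mul_const (D / (lam - 1) ^ 2)
    rwa [zero_mul] at h'
  · calc |greenSolI (fun t => sph lam (hyp t)) (sphDecay lam) g t
          - ∑ k ∈ Finset.range (n + 1), (lam * (lam - 2) - lam₂ * (lam₂ - 2)) ^ k
            * (greenSolI (fun t => sph lam₂ (hyp t)) (sphDecay lam₂))^[k + 1] g t|
        ≤ q ^ (n + 1) * (D * sph 1 (hyp t) / (lam - 1) ^ 2) :=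
          abs_neumann_remainder_le_mul_sph_one hlam hg hD hlam₂ n ht
      _ = (q ^ (n + 1) * (D / (lam - 1) ^ 2)) * sph 1 (hyp t) := by ring

end measure

end Summit.Ventures.HodgeRepro2.T5SU11WeightedSpaceGroundState
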